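import Mathlib
import Literature.NumberTheory.Automorphic.HilbertModularFormQExpansion
import Literature.Analysis.FunctionSpaces.TorusScalarFourierSeries
import Literature.Analysis.FunctionSpaces.FlatTorusProofs

/-!
# The Fourier expansion of a smooth `ℤ^ι`-periodic function over the unit cube (stub L2b)

Stub L2b `stub_hasSum_cube` of line Sketch-ideate-r1-k1 (section L, RESHAPE 8) for the crux
`HilbertIntegralOverconvergentIsCongruence` (stmt-Langlands-8485): a real `C^∞` function `g` on `ℝ^ι` that
is periodic under `ℤ^ι` is the sum of its Fourier series
`g(x₀) = ∑_{n ∈ ℤ^ι} (∫_{[0,1]^ι} g(x) e^{-2πi n·x} dx) e^{2πi n·x₀}`, and the coefficients are absolutely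
summable (Grafakos, *Classical Fourier Analysis*, Thm. 3.3.9 / §3.3.3).  This is the transport to the cube
`[0,1]^ι ⊆ ℝ^ι` of the tree's torus statements `Literature.Analysis.FunctionSpaces.Torus.hasSum_mFourier_scalar`
and `…summable_norm_mFourierCoeff_scalar` (smooth functions on `UnitAddTorus ι`): `g ∘ ofLp` is a
lattice-periodic function on `EuclideanSpace ℝ ι`, it descends to a smooth function on the torus
(`Torus.descend`, `Torus.lift_descend_holds`), and Mathlib's `UnitAddTorus.mFourierCoeff_eq_integral` computes
the torus coefficients as integrals over the cube `∏ (0, 1]`, a.e. equal to `[0,1]^ι`.  It is the torus half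
of the Fourier expansion on the tube domain (Freitag, *Hilbert Modular Forms*, I.4.1).
-/

set_option linter.dupNamespace false

noncomputable section

namespace Summit.Langlands.Langlands.Theorems.HilbertIntegralOverconvergentIsCongruence

open MeasureTheory Complex
open Literature.Analysis.FunctionSpaces

/-- The torus character at a point given by real coordinates: `e_k(x mod ℤ^ι) = e^{2πi k·x}`. -/
theorem hsc_mFourier_coe {ι : Type} [Fintype ι] (k : ι → ℤ) (x : ι → ℝ) :
    UnitAddTorus.mFourier k (fun i ↦ ((x i : ℝ) : UnitAddCircle)) =
      cexp (2 * Real.pi * I * (∑ i, (k i : ℝ) * x i : ℝ)) := by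
  simp only [UnitAddTorus.mFourier, ContinuousMap.coe_mk, fourier_coe_apply]
  rw [← Complex.exp_sum]
  congr 1
  push_cast
  rw [Finset.mul_sum]
  refine Finset.sum_congr rfl fun i _ ↦ ?_
  ring

/-- The character at the negative frequency: `e_{-k}(x) = e^{-2πi k·x}`. -/
theorem hsc_mFourier_neg_coe {ι : Type} [Fintype ι] (k : ι → ℤ) (x : ι → ℝ) :
    UnitAddTorus.mFourier (-k) (fun i ↦ ((x i : ℝ) : UnitAddCircle)) =
      cexp (-(2 * Real.pi * I * (∑ i, (k i : ℝ) * x i : ℝ))) := by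
  rw [hsc_mFourier_coe]
  congr 1
  have : (∑ i, ((-k) i : ℝ) * x i : ℝ) = -(∑ i, (k i : ℝ) * x i) := by
    rw [← Finset.sum_neg_distrib]
    exact Finset.sum_congr rfl fun i _ ↦ by simp
  rw [this]
  push_cast
  ring

/-- **Stub L2b — `stub_hasSum_cube`.** The Fourier expansion of a smooth `ℤ^ι`-periodic function on
`ℝ^ι`: `g(x₀) = ∑_{n ∈ ℤ^ι} (∫_{[0,1]^ι} g(x) e^{-2πi n·x} dx) e^{2πi n·x₀}`, and the coefficients are absolutely
summable (transport of the tree's `Torus.hasSum_mFourier_scalar` / `Torus.summable_norm_mFourierCoeff_scalar` along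
the covering map `ℝ^ι → T^ι`, with Mathlib's `UnitAddTorus.mFourierCoeff_eq_integral` for the coefficients).
[cite: Grafakos2014, Thm. 3.3.9] -/
theorem stub_hasSum_cube {ι : Type} [Fintype ι] (g : (ι → ℝ) → ℂ) (hg : ContDiff ℝ (⊤ : ℕ∞) g)
    (hper : ∀ (m : ι → ℤ) (x : ι → ℝ), g (x + fun i ↦ (m i : ℝ)) = g x) (x₀ : ι → ℝ) :
    HasSum (fun n : ι → ℤ ↦
        (∫ x in Set.Icc (0 : ι → ℝ) 1, g x * cexp (-(2 * Real.pi * I * (∑ i, (n i : ℝ) * x i : ℝ)))) *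
          cexp (2 * Real.pi * I * (∑ i, (n i : ℝ) * x₀ i : ℝ))) (g x₀) ∧
      Summable (fun n : ι → ℤ ↦
        ‖∫ x in Set.Icc (0 : ι → ℝ) 1, g x * cexp (-(2 * Real.pi * I * (∑ i, (n i : ℝ) * x i : ℝ)))‖) := by
  classical
  -- the lattice-periodic function on `EuclideanSpace ℝ ι` and its descent to the torus
  set G : EuclideanSpace ℝ ι → ℂ := fun v ↦ g (WithLp.ofLp v) with hGdef
  have hGper : Torus.IsLatticePeriodic G := by
    intro j v
    have hsingle : WithLp.ofLp (EuclideanSpace.single j (1 : ℝ)) =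
        fun i ↦ ((Pi.single j (1 : ℤ) : ι → ℤ) i : ℝ) := by
      funext i
      change (WithLp.toLp 2 (Pi.single j (1 : ℝ)) : EuclideanSpace ℝ ι).ofLp i = _
      rw [WithLp.ofLp_toLp, Pi.single_apply, Pi.single_apply]
      split_ifs <;> simp
    simp only [hGdef, WithLp.ofLp_add, hsingle]
    exact hper _ _
  set f₀ : UnitAddTorus ι → ℂ := Torus.descend G hGper with hf₀def
  have hlift : Torus.lift f₀ = G := Torus.lift_descend_holds G hGper
  have hf₀ : Torus.IsSmooth f₀ := by
    show ContDiff ℝ _ (Torus.lift f₀)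
    rw [hlift]
    exact hg.comp PiLp.contDiff_ofLp
  -- values at real points
  have hval : ∀ x : ι → ℝ, f₀ (fun i ↦ ((x i : ℝ) : UnitAddCircle)) = g x := by
    intro x
    have h := congrFun hlift (WithLp.toLp 2 x)
    rw [Torus.lift_apply, Torus.proj_toLp] at h
    rw [h, hGdef]
  -- the torus Fourier coefficients are the cube integrals
  have hcoeff : ∀ n : ι → ℤ, UnitAddTorus.mFourierCoeff f₀ n =
      ∫ x in Set.Icc (0 : ι → ℝ) 1, g x * cexp (-(2 * Real.pi * I * (∑ i, (n i : ℝ) * x i : ℝ))) := by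
    intro n
    rw [UnitAddTorus.mFourierCoeff_eq_integral f₀ n 0]
    have hset : {x : ι → ℝ | ∀ i, x i ∈ Set.Ioc ((0 : ι → ℝ) i) ((0 : ι → ℝ) i + 1)} =
        Set.pi Set.univ fun i ↦ Set.Ioc ((0 : ι → ℝ) i) ((1 : ι → ℝ) i) := by
      ext x
      simp
    have hae : {x : ι → ℝ | ∀ i, x i ∈ Set.Ioc ((0 : ι → ℝ) i) ((0 : ι → ℝ) i + 1)} =ᵐ[volume]
        Set.Icc (0 : ι → ℝ) 1 := by
      rw [hset, volume_pi]
      exact Measure.univ_pi_Ioc_ae_eq_Icc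
    rw [setIntegral_congr_set hae]
    refine setIntegral_congr_fun measurableSet_Icc fun x _ ↦ ?_
    rw [hval x, hsc_mFourier_neg_coe, smul_eq_mul, mul_comm]
  -- the expansion on the torus, read at real points
  have hsum := Torus.hasSum_mFourier_scalar hf₀ (fun i ↦ ((x₀ i : ℝ) : UnitAddCircle))
  rw [hval x₀] at hsum
  refine ⟨?_, ?_⟩
  · refine hsum.congr_fun fun n ↦ ?_
    rw [hcoeff n, hsc_mFourier_coe]
  · exact (Torus.summable_norm_mFourierCoeff_scalar hf₀).congr fun n ↦ by rw [hcoeff n]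

end Summit.Langlands.Langlands.Theorems.HilbertIntegralOverconvergentIsCongruence
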